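import Mathlib
import Literature.Analysis.FluidPDE.NSWave0
import Literature.Analysis.FluidPDE.ClassicalSolution
import Literature.Analysis.FluidPDE.AxisymmetricEuler
import Literature.Analysis.FluidPDE.AxisymmetricVorticityTransport
import Literature.Analysis.FluidPDE.IsometryInvariance
import Literature.Analysis.FluidPDE.CurlFreeLiouville
import Literature.Analysis.FluidPDE.HarmonicOfSmallStencil
import Literature.Analysis.FluidPDE.HelmholtzAnnihilator
import Literature.Analysis.FluidPDE.ClassicalNSBlowupAlternative
import Literature.Analysis.FluidPDE.NSLerayHopf
import Literature.Claims.NS.ClayVariants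
import HarnessLib

/-!
# Claim skeleton (D-0090 NS-CLAIMS, C11b): Shahmurov, arXiv:2606.07875 v1 (RED) + arXiv:2606.07869 v1 (AX) — the June reduction chain

Typed skeleton of the SUB-ROW C11b `Shahmurov2026c` of the C11 cluster (lead rulings 2026-08-26T15:38Z /
16:10Z): RED = Rishad Shahmurov, *Hypothetical Singularity of 3D Navier–Stokes in Clay Institute set up
Reduces to Axisymmetric with Swirl class*, arXiv:2606.07875 **v1 of 2026-06-05** (only version; 68 pp.;
bib `Shahmurov2026`; locators `l.N` = TeX line of the pinned e-print
`pub/ns-claims/sources/Shahmurov2026/arxiv-2606.07875/v1-2026-06-05-Shahmurov_v37_final_lock.tex`, `p.N` =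
PDF page, both from ns-claims-lit-2's `LOCATORS-2606.07875-reduction.md`), together with ONE imported step
from the companion AX = *Global Regularity for Axisymmetric Navier–Stokes Flows with Swirl*, arXiv:2606.07869
v1 (bib `Shahmurov2026Axisym`; TeX `…_v31_route_lock.tex`). UNREFEREED CLAIMS under adjudication — NOTHING
in this file asserts a step of either paper: their statements are `def … : Prop`; the `theorem`s are
kernel-checked relations between them. Card `pub/ns-claims/claims/Shahmurov2026c/CARD.md` (PREDICTION §4
frozen 2026-08-26T20:47Z); refuter-4, ref-3 (RETYPE.md v0). Sibling rows: C11 = T arXiv:2605.09797 v2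
(`Literature.Claims.NS.Shahmurov2026`), C12 (`…Shahmurov2026b`).

## The claimed statements (RED §2, p.7)

* **Definition 2.1** (l.234–236): (G) := "every smooth finite-energy solution of (2.1) remains smooth
  globally in time"; (AS) := "the same statement restricted to smooth finite-energy axisymmetric solutions
  with arbitrary swirl" — `StatementG ν`, `StatementAS ν` (a smooth finite-energy solution on `[0,T)` =
  `IsSmoothFiniteEnergySolutionOn`; "remains smooth" = the tree's `HasSmoothExtensionPast` at every finite
  `T`, i.e. no finite-time first singularity, `HasFirstSingularity`).
* **Theorem 2.2** (l.239–241): "Let `u` be a smooth finite-energy solution of (2.1) on its maximal time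
  interval. If a finite-time first singularity occurs, then there exists a normalized terminal first-threshold
  endpoint in the axisymmetric-with-swirl class. …" — `Thm22 K` (below: the endpoint/terminality vocabulary).
* **Corollary 2.3** (l.243–245): (AS) ⇒ (G) — `cor23_of_steps`.
* **AX Theorem 1.1** (AX l.138–146): "Let `u₀ ∈ C_c^∞(ℝ³)` be divergence-free and axisymmetric. Let `u` be
  the corresponding smooth axisymmetric Navier–Stokes solution on its maximal interval `[0,T_*)`. Then
  `T_* = ∞`." — `Step_AX11` (imported black box per the lead's ruling).
* The pair's joint claim = `ClaimedTheorem := ∀ ν > 0, StatementG ν` ((G) for every viscosity; (G) ⊇ Clay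
  (A) modulo local existence and the energy bound (7), both classical — summit-side glue, not typed here).

## Architecture (RED "staircase" l.190–206, §13) and the typed steps

S1 packet selection at `e_sing = ε_reg` (Lemma 3.6 p.8 ⇐ Thm 3.3 p.7–8, Gustafson–Kang–Tsai) — CONCRETE:
packets `Q_R(x₀,t₀) = B_R(x₀) × (t₀−R², t₀)` (Def 3.1), the critical score (3.1) p.7 (`packetScore`, cutoff
`φ_R` replaced by the indicator — typist's simplification, flagged), `Step_L36`. S2 amplitude identity
(Lemma 4.1 p.9) — a pointwise computation, not typed separately. S3 zero production ⇒ Nash–Liouville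
(Thm 5.4 p.10) — CONCRETE `Step_T54` (for the record; consumed only inside S8's printed proof). S4–S7
(Prop 6.1, Lemma 6.2, Prop 7.8, Thm 7.9, Thm 8.1, Thm 9.8, Thms 10.6/10.7/10.8/10.18/10.19; p.11–39) and the
OUTPUT LEDGER (O1)–(O9) (Def 3.7 p.9), "strict active descendant", "selected-output rank" are defined in
PROSE (referee F1): they enter through the explicit parameter `K : Ledger` (thresholds of Def 3.4 with their
displayed constraints + the normalized outputs and the descendant relation as bare functions) — every Step
that mentions them is a closed Prop once `K` is bound, and a verdict names `K`'s fields honestly as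
uninterpreted. S7/S9 SELECTION ("choose the terminal sequence so that every visible output and active
descendant has been either selected or exhausted by the finite-overlap stopping order", proof of Thm 2.2
l.1712–1714; Thms 10.18–10.19 p.38–39) — `Step_selection K`. S8 terminal exhaustion (Lemma 11.1 p.39,
**Thm 11.2 p.40**, Thm 9.19 / Lemma 9.18 p.27) — `Step_T112 K`; the flat branch "is regular by the classical
two-dimensional theory" (l.1715, l.1719) — `Step_flat K`; Lemma 9.18 in the referee's charitable `L²` form —
CONCRETE `Step_L918_L2` (R#a; for the record). S9 ⇒ Thm 2.2 (`thm22_of_steps`) ⇒ Cor 2.3 (`Step_Cor23 K` = the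
sentence "(AS) excludes the only possible terminal singular endpoint", l.1716–1718; `cor23_of_steps`). S10
interface (§12: Thm 12.4 p.43, **Cor 12.5 p.44**; AX Thm l.6314–6321 + Cor l.6323–6329): the companion's
ENDPOINT theorem `EndpointExclusionAX K ν` (imported: `Step_AXendpoint K`) — `claim_of_steps` (route of
record, the papers' own interface) — or Def 2.1's route `Step_AX11 → Step_AS_of_AX → Step_Cor23`
(`claim_of_steps_def21`).

Rev 3 (refuter-4's battery note T1–T2, 22:14Z, non-blocking for the verdict): endpoint predicates now see
only `s < 0` (`IsAxisymmetricFlowOn (Iio 0)`, `IsFlatTwoDimensionalOn (Iio 0)`) and `IsTerminalSequence` carries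
`R_k → 0`, `t_k → T` — removing two junk-refutability artefacts of the typing (not of the print).

COMPOSITION: both routes compose (pure logic): `claim_of_steps (K) : Step_selection K → Step_T112 K →
Step_flat K → Step_AXendpoint K → ClaimedTheorem` and `claim_of_steps_def21 (K) : Step_selection K →
Step_T112 K → Step_flat K → Step_Cor23 K → Step_AX11 → Step_AS_of_AX → ClaimedTheorem`.

WHAT THIS IS NOT: not a claim about NS regularity or blow-up; not a claim about any author beyond the typed
locator.
-/

open scoped ENNReal NNReal Topology
open _root_.MeasureTheory _root_.Set _root_.Filter _root_.Metric

namespace Literature.Claims.NS.Shahmurov2026c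

open Literature.Analysis.FluidPDE

noncomputable section

/-- Physical space `ℝ³`. [folklore] -/
abbrev E3 : Type := EuclideanSpace ℝ (Fin 3)

/-! ## A. Solutions, singularities, (G), (AS), AX Thm 1.1 (concrete) -/

/-- **A smooth finite-energy solution on `[0,T)`** (RED §2 l.215–222, Def 2.1 l.234–236): a classical
solution `(u,p)` of (2.1) (`f ≡ 0`, viscosity `ν`) on `ℝ³ × [0,T)` (the tree's `IsClassicalNSSolutionOn`,
smooth in space-time) with `sup_{t<T} ‖u(t)‖_{L²} < ∞`. [cite: Shahmurov2026, Def 2.1 l.234–236 (p.7)] -/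
def IsSmoothFiniteEnergySolutionOn (ν T : ℝ) (u : ℝ → E3 → E3) (p : ℝ → E3 → ℝ) : Prop :=
  IsClassicalNSSolutionOn (Ico 0 T) ν 0 u p ∧
    ∃ M : ℝ, ∀ t ∈ Ico 0 T, MemLp (u t) 2 (volume : Measure E3) ∧
      (eLpNorm (u t) 2 (volume : Measure E3)).toReal ≤ M

/-- **A finite-time first singularity at `T`** (Thm 2.2 l.239: "on its maximal time interval. If a finite-time
first singularity occurs"): a smooth finite-energy solution on `[0,T)`, `0 < T < ∞`, with NO smooth
continuation past `T` (tree `HasSmoothExtensionPast`). [cite: Shahmurov2026, Thm 2.2 l.239–241 (p.7)] -/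
def HasFirstSingularity (ν T : ℝ) (u : ℝ → E3 → E3) (p : ℝ → E3 → ℝ) : Prop :=
  0 < T ∧ IsSmoothFiniteEnergySolutionOn ν T u p ∧ ¬ HasSmoothExtensionPast ν 0 u T

/-- **(G)** (Def 2.1 l.234–236): "every smooth finite-energy solution of (2.1) remains smooth globally in
time" — no smooth finite-energy solution on any `[0,T)`, `T < ∞`, has a first singularity at `T`.
[cite: Shahmurov2026, Def 2.1 l.234–236 (p.7)] -/
def StatementG (ν : ℝ) : Prop :=
  ∀ (T : ℝ) (u : ℝ → E3 → E3) (p : ℝ → E3 → ℝ), 0 < T →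
    IsSmoothFiniteEnergySolutionOn ν T u p → HasSmoothExtensionPast ν 0 u T

/-- A time-dependent field is **axisymmetric about a fixed axis** (some line `c + ℝ·Qe₃`): after a rigid
motion it is axisymmetric about the `x₂`-axis in the tree's sense (`IsAxisymmetric`: `u(R_θ x) = R_θ u(x)`),
at every time; arbitrary swirl allowed. [cite: Shahmurov2026, Def 2.1 l.234–236 (p.7)] -/
def IsAxisymmetricFlow (U : ℝ → E3 → E3) : Prop :=
  ∃ (c : E3) (Q : E3 ≃ₗᵢ[ℝ] E3), ∀ s : ℝ, IsAxisymmetric (fun y => Q.symm (U s (c + Q y)))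

/-- A time-dependent field is **axisymmetric about a fixed axis ON THE TIME SET `S`** (rev 3, refuter-4 T1:
endpoint uses must see only `s < 0`, where `IsEndpointOf`/`IsNonzeroAncient` constrain the field; with the
all-times predicate the endpoint steps were junk-refutable by modifying `U` at `s ≥ 0`).
[cite: Shahmurov2026, Def 2.1 l.234–236 (p.7)] -/
def IsAxisymmetricFlowOn (S : Set ℝ) (U : ℝ → E3 → E3) : Prop :=
  ∃ (c : E3) (Q : E3 ≃ₗᵢ[ℝ] E3), ∀ s ∈ S, IsAxisymmetric (fun y => Q.symm (U s (c + Q y)))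

/-- All-times axisymmetry implies axisymmetry on any time set. [cite: Shahmurov2026, Def 2.1 l.234–236 (p.7)] -/
theorem IsAxisymmetricFlow.on {U : ℝ → E3 → E3} (h : IsAxisymmetricFlow U) (S : Set ℝ) :
    IsAxisymmetricFlowOn S U := by
  obtain ⟨c, Q, hQ⟩ := h
  exact ⟨c, Q, fun s _ => hQ s⟩

/-- **(AS)** (Def 2.1 l.234–236): (G) "restricted to smooth finite-energy axisymmetric solutions with
arbitrary swirl". [cite: Shahmurov2026, Def 2.1 l.234–236 (p.7)] -/
def StatementAS (ν : ℝ) : Prop :=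
  ∀ (T : ℝ) (u : ℝ → E3 → E3) (p : ℝ → E3 → ℝ), 0 < T →
    IsSmoothFiniteEnergySolutionOn ν T u p → IsAxisymmetricFlow u → HasSmoothExtensionPast ν 0 u T

/-- **AX Theorem 1.1** (arXiv:2606.07869 v1, l.138–146), THE IMPORTED STEP: "Let `u₀ ∈ C_c^∞(ℝ³)` be
divergence-free and axisymmetric. Let `u` be the corresponding smooth axisymmetric Navier–Stokes solution on
its maximal interval `[0,T_*)`. Then `T_* = ∞`" ("The viscosity `ν > 0` is fixed", l.130) — every classical
axisymmetric solution on `[0,T)` from such a datum extends past `T`. [claim: Shahmurov2026Axisym, status: under-review] -/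
def Step_AX11 : Prop :=
  ∀ ν : ℝ, 0 < ν → ∀ u₀ : E3 → E3, ContDiff ℝ (⊤ : ℕ∞) u₀ → HasCompactSupport u₀ →
    NSWave0.IsDivFree u₀ → IsAxisymmetric u₀ →
    ∀ (T : ℝ) (u : ℝ → E3 → E3) (p : ℝ → E3 → ℝ), 0 < T →
      IsClassicalNSSolutionOn (Ico 0 T) ν 0 u p → u 0 = u₀ → (∀ t ∈ Ico 0 T, IsAxisymmetric (u t)) →
      HasSmoothExtensionPast ν 0 u T

/-- **Interface Def 2.1 ↔ AX Thm 1.1** (referee F2; lit-2 «Interface facts (i)»): Cor 2.3 consumes (AS) for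
ALL smooth finite-energy axisymmetric solutions (any axis), whereas AX Thm 1.1 is printed for `C_c^∞` data
axisymmetric about a coordinate axis; the chain via Def 2.1 needs "AX Thm 1.1 ⇒ (AS) for every `ν > 0`".
Typed as that implication (no proof is printed in either paper). [claim: Shahmurov2026, status: under-review] -/
def Step_AS_of_AX : Prop :=
  Step_AX11 → ∀ ν : ℝ, 0 < ν → StatementAS ν

/-- **The pair's joint claim**: (G) for every viscosity `ν > 0` (RED Cor 2.3 + AX Thm 1.1, resp. RED Cor 12.5
+ AX Cor l.6323–6329). [claim: Shahmurov2026, status: under-review] -/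
def ClaimedTheorem : Prop :=
  ∀ ν : ℝ, 0 < ν → StatementG ν

/-! ## B. Packets, the critical score (3.1), rescaling, endpoints (concrete) -/

/-- Partial derivative `∂_i v_j (x)` of a vector field (Fréchet derivative along `e_i`, component `j`).
[folklore] -/
def pd (v : E3 → E3) (x : E3) (i j : Fin 3) : ℝ :=
  (fderiv ℝ v x (EuclideanSpace.single i (1 : ℝ))) j

/-- The vorticity `ω = curl u` (RED §2 l.221), componentwise. [cite: Shahmurov2026, §2 l.215–222 (p.6)] -/
def curl3 (v : E3 → E3) (x : E3) : E3 :=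
  WithLp.toLp 2 ![pd v x 1 2 - pd v x 2 1, pd v x 2 0 - pd v x 0 2, pd v x 0 1 - pd v x 1 0]

/-- **The critical score (3.1)** (Def 3.2 l.257–265, p.7) of the packet `Q_R(x₀,t₀) = B_R(x₀) × (t₀−R²,t₀)`
(Def 3.1 l.249): `𝒬(Q_R) = sup_{t∈I_R} R∫_{B_R}φ_R²|ω|² + R⁻¹∬_{Q_R}φ_R²|ω|²`, in `ℝ≥0∞`, with the smooth
cutoff `φ_R` REPLACED BY THE INDICATOR of `B_R` (typist's simplification — the print fixes no `φ_R`; Thm 3.3's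
display is cutoff-free). [cite: Shahmurov2026, Def 3.2 (3.1) l.257–265 (p.7)] -/
def packetScore (u : ℝ → E3 → E3) (x₀ : E3) (t₀ R : ℝ) : ℝ≥0∞ :=
  (⨆ t ∈ Ioo (t₀ - R ^ 2) t₀, ENNReal.ofReal R * ∫⁻ x in ball x₀ R, ‖curl3 (u t) x‖ₑ ^ 2) +
    ENNReal.ofReal R⁻¹ * ∫⁻ t in Ioo (t₀ - R ^ 2) t₀, ∫⁻ x in ball x₀ R, ‖curl3 (u t) x‖ₑ ^ 2

/-- **Parabolic rescaling around a packet** (RED §2 scaling l.228–232; Thm 2.2 "after parabolic rescaling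
around a singularity-forcing packet"): `u_k(y,s) = R u(x₀ + R y, t₀ + R² s)`.
[cite: Shahmurov2026, §2 l.228–232 (p.6–7)] -/
def packetRescale (u : ℝ → E3 → E3) (x₀ : E3) (t₀ R : ℝ) : ℝ → E3 → E3 :=
  fun s y => R • u (t₀ + R ^ 2 * s) (x₀ + R • y)

/-- **An endpoint of a packet sequence** ("terminal ancient endpoint obtained from `Q_k`", Thm 9.19 l.1186,
Thm 11.2 l.1702; compactness Thm 10.19 p.39): an ancient field `U` on `ℝ³ × (−∞,0)` to which a subsequence of
the rescaled solutions converges in `L²_loc(ℝ³ × (−∞,0))`. (The print's topology — "local energy", "local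
weak sense", §10/§12 — is not displayed; `L²_loc` of velocities is the typist's reading, flagged.)
[cite: Shahmurov2026, Thm 10.19 l.1669–1676 (p.39)] -/
def IsEndpointOf (u : ℝ → E3 → E3) (x : ℕ → E3) (t R : ℕ → ℝ) (U : ℝ → E3 → E3) : Prop :=
  ∃ φ : ℕ → ℕ, StrictMono φ ∧ ∀ (ρ S : ℝ), 0 < ρ → 0 < S →
    Tendsto (fun k => ∫⁻ s in Ioo (-S) 0, ∫⁻ y in ball (0 : E3) ρ,
        ‖packetRescale u (x (φ k)) (t (φ k)) (R (φ k)) s y - U s y‖ₑ ^ 2) atTop (𝓝 0)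

/-- A **nonzero** ancient field on `(−∞,0)`: not a.e. zero at every negative time.
[cite: Shahmurov2026, Thm 11.2 l.1702–1708 (p.40)] -/
def IsNonzeroAncient (U : ℝ → E3 → E3) : Prop :=
  ¬ ∀ s ∈ Iio (0 : ℝ), ∀ᵐ y ∂(volume : Measure E3), U s y = 0

/-- A **flat two-dimensional** field ("fixed vorticity direction gives, after rotation, `Ω = (0,0,α)` … the
velocity is two-dimensional", proof of Lemma 11.1 l.1694; "flat two-dimensional endpoint", Thm 11.2): after a
rigid motion, independent of `x₂` with vanishing third component, at every time (the print's "up to harmonic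
or moving-frame parts already present in the ledger" is dropped — flagged). [cite: Shahmurov2026, Lemma 11.1 l.1685–1696 (p.39)] -/
def IsFlatTwoDimensional (U : ℝ → E3 → E3) : Prop :=
  ∃ (c : E3) (Q : E3 ≃ₗᵢ[ℝ] E3), ∀ (s : ℝ) (y : E3),
    (Q.symm (U s (c + Q y))) 2 = 0 ∧
      ∀ h : ℝ, Q.symm (U s (c + Q (y + h • EuclideanSpace.single 2 (1 : ℝ)))) = Q.symm (U s (c + Q y))

/-- **Flat two-dimensional ON THE TIME SET `S`** (rev 3, refuter-4 T1; endpoint uses take `S = Iio 0`).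
[cite: Shahmurov2026, Lemma 11.1 l.1685–1696 (p.39)] -/
def IsFlatTwoDimensionalOn (S : Set ℝ) (U : ℝ → E3 → E3) : Prop :=
  ∃ (c : E3) (Q : E3 ≃ₗᵢ[ℝ] E3), ∀ s ∈ S, ∀ (y : E3),
    (Q.symm (U s (c + Q y))) 2 = 0 ∧
      ∀ h : ℝ, Q.symm (U s (c + Q (y + h • EuclideanSpace.single 2 (1 : ℝ)))) = Q.symm (U s (c + Q y))

/-! ## C. The output ledger as an explicit parameter (prose-defined atoms, referee F1) -/

/-- **The ledger** — the quantities RED defines in prose and uses in every statement of §5–§11: the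
thresholds of Def 3.4 p.8 ("Fix constants `0 < e_low < e_warn < e_sing := ε_reg` with
`e_low ≤ c_desc δ₀² e_sing`", l.281–285) with their displayed constraints, the eight NORMALIZED OUTPUTS
(O1)–(O8) of Def 3.7 p.9 (l.309–321; (O9) "axisymmetric orbit endpoint" is the conclusion, not an output to be
excluded) as bare real-valued functions of (solution, packet), and the "strict active descendant" relation
(Lemma 3.6, §7, Def 9.x) as a bare predicate. Nothing about them is asserted; Steps quantify over or are
parameterised by `K : Ledger`. [cite: Shahmurov2026, Def 3.4 l.281–285 (p.8); Def 3.7 l.309–321 (p.9)] -/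
structure Ledger where
  /-- `e_low` (Def 3.4). -/
  eLow : ℝ
  /-- `e_warn` (Def 3.4). -/
  eWarn : ℝ
  /-- `e_sing := ε_reg` (Def 3.4, Thm 3.3). -/
  eSing : ℝ
  /-- the finite-overlap descendant constant `c_desc` (Def 3.4). -/
  cDesc : ℝ
  /-- the nonperturbative-output threshold `δ₀` (Def 3.4). -/
  δ₀ : ℝ
  low_pos : 0 < eLow
  low_lt_warn : eLow < eWarn
  warn_lt_sing : eWarn < eSing
  low_le : eLow ≤ cDesc * δ₀ ^ 2 * eSing
  /-- the normalized outputs (O1)–(O8) of a packet `Q_R(x₀,t₀)` of a solution `u` (Def 3.7; prose). -/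
  output : Fin 8 → (ℝ → E3 → E3) → E3 → ℝ → ℝ → ℝ
  /-- "the packet `Q_R(x₀,t₀)` of `u` has a strict active descendant" (Lemma 3.6, §7, §9; prose). -/
  HasStrictActiveDescendant : (ℝ → E3 → E3) → E3 → ℝ → ℝ → Prop

/-- **A terminal singularity-forcing sequence with all named outputs and strict active descendants absent**
(hypothesis of Lemma 11.1 l.1685 / Thm 11.2 l.1702; Def 3.4 "singularity-forcing if `𝒬(Q) ≥ e_sing`"; Def 3.7
"A terminal zero-output sequence is one for which every normalized output above tends to zero"): packets
`Q_{R_k}(x_k,t_k)` inside the regularity slab (`0 < t_k − R_k²`, `t_k ≤ T`), SHRINKING TO THE SINGULAR TIME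
(`R_k → 0`, `t_k → T`; rev 3, refuter-4 T2: without the limits constant packet sequences qualified), scores
`≥ e_sing`, every output `→ 0`, no strict active descendant along the sequence. [cite: Shahmurov2026, Def 3.7 l.309–322 (p.9); Thm 11.2 l.1702–1708 (p.40)] -/
def IsTerminalSequence (K : Ledger) (T : ℝ) (u : ℝ → E3 → E3) (x : ℕ → E3) (t R : ℕ → ℝ) : Prop :=
  (∀ k, 0 < R k ∧ 0 < t k - R k ^ 2 ∧ t k ≤ T) ∧
    (Tendsto R atTop (𝓝 0) ∧ Tendsto t atTop (𝓝 T)) ∧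
    (∀ k, ENNReal.ofReal K.eSing ≤ packetScore u (x k) (t k) (R k)) ∧
    (∀ i : Fin 8, Tendsto (fun k => K.output i u (x k) (t k) (R k)) atTop (𝓝 0)) ∧
    ∀ k, ¬ K.HasStrictActiveDescendant u (x k) (t k) (R k)

/-! ## D. The steps -/

/-- **Lemma 3.6 — singularity-forcing packet selection** (l.297–307, p.8; ⇐ Thm 3.3 p.7–8, the `p = q = 2`
vorticity case of Gustafson–Kang–Tsai): "If a smooth finite-energy solution develops a finite-time first
singularity at `(x_*,T)`, then there are radii `R_k ↓ 0` and packets `Q_{R_k}(x_k,t_k)` with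
`(x_k,t_k) → (x_*,T)` such that `𝒬(Q_{R_k}) ≥ e_sing = ε_reg`" (the singular point `x_*` is produced, not given:
a first singularity of a finite-energy smooth solution has one — folded in). [claim: Shahmurov2026, status: under-review] -/
def Step_L36 (K : Ledger) : Prop :=
  ∀ (ν T : ℝ) (u : ℝ → E3 → E3) (p : ℝ → E3 → ℝ), 0 < ν → HasFirstSingularity ν T u p →
    ∃ (x : ℕ → E3) (t R : ℕ → ℝ) (xs : E3),
      (∀ k, 0 < R k ∧ 0 < t k - R k ^ 2 ∧ t k ≤ T) ∧ Tendsto R atTop (𝓝 0) ∧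
      Tendsto x atTop (𝓝 xs) ∧ Tendsto t atTop (𝓝 T) ∧
      ∀ k, ENNReal.ofReal K.eSing ≤ packetScore u (x k) (t k) (R k)

/-- **Theorem 5.4 — Nash–Liouville** (l.403–407, p.10), CONCRETE: "Let `A ≥ 0` be a bounded ancient
transported heat subsolution with `div U = 0` and `M = sup_{τ≤0} ∫A(y,τ)dy < ∞`. If `F(τ) = ∫A²(y,τ)dy` is
bounded on `(−∞,0]`, then `A ≡ 0`" — typed for `C²`-in-space, `C¹`-in-time `A` with
`∂_τA + U·∇A − νΔA ≤ 0` pointwise on `ℝ³ × (−∞,0]` (Mathlib's `Laplacian`), `U` smooth divergence-free. For the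
record (consumed inside the printed proof of Thm 11.2). [claim: Shahmurov2026, status: under-review] -/
def Step_T54 : Prop :=
  ∀ (ν : ℝ) (A : ℝ → E3 → ℝ) (U : ℝ → E3 → E3), 0 < ν →
    ContDiff ℝ 2 (fun q : ℝ × E3 => A q.1 q.2) → ContDiff ℝ 1 (fun q : ℝ × E3 => U q.1 q.2) →
    (∀ τ, NSWave0.IsDivFree (U τ)) →
    (∀ τ ∈ Iic (0 : ℝ), ∀ y, 0 ≤ A τ y) → (∃ B : ℝ, ∀ τ ∈ Iic (0 : ℝ), ∀ y, A τ y ≤ B) →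
    (∀ τ ∈ Iic (0 : ℝ), ∀ y,
      deriv (fun σ => A σ y) τ + (fderiv ℝ (A τ) y) (U τ y) - ν * Laplacian.laplacian (A τ) y ≤ 0) →
    (∃ M : ℝ, ∀ τ ∈ Iic (0 : ℝ), Integrable (A τ) (volume : Measure E3) ∧ ∫ y, A τ y ≤ M) →
    (∃ F : ℝ, ∀ τ ∈ Iic (0 : ℝ),
      Integrable (fun y => A τ y ^ 2) (volume : Measure E3) ∧ ∫ y, A τ y ^ 2 ≤ F) →
    ∀ τ ∈ Iic (0 : ℝ), ∀ y, A τ y = 0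

/-- **Lemma 9.18 in the referee's charitable `L²` form** (R#a, RETYPE.md §2; print l.1144–1150, p.27 with the
outputs clause): a `C¹`, square-integrable, divergence-free field on `ℝ³` whose vorticity is equivariant under
all rotations about the `x₂`-axis is itself axisymmetric (Biot–Savart uniqueness in `L²`). For the record —
TRUE classically; the printed lemma lives on local-energy ancient profiles with the harmonic-gradient
discrepancy excluded by the outputs clause. [claim: Shahmurov2026, status: under-review] -/
def Step_L918_L2 : Prop :=
  ∀ v : E3 → E3, ContDiff ℝ 1 v → MemLp v 2 (volume : Measure E3) → NSWave0.IsDivFree v →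
    (∀ θ x, curl3 v (rotZ θ x) = rotZ θ (curl3 v x)) → IsAxisymmetric v

/-- **SELECTION** (proof of Thm 2.2 l.1712–1714: "Select a singularity-forcing packet in the threshold band and
normalize it to unit scale. Passing to a terminal ancient endpoint, choose the terminal sequence so that every
visible output and active descendant has been either selected or exhausted by the finite-overlap stopping
order. If a non-axisymmetric output or descendant remained, the terminal sequence would not be terminal";
Thm 10.18 well-founded selected-output rank p.38, Thm 10.19 profile compactness p.39, Lemma 3.6): a first
singularity admits a terminal singularity-forcing sequence with all outputs and strict descendants absent,
shrinking to the singular time, with a NONZERO endpoint. [claim: Shahmurov2026, status: under-review] -/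
def Step_selection (K : Ledger) : Prop :=
  ∀ (ν T : ℝ) (u : ℝ → E3 → E3) (p : ℝ → E3 → ℝ), 0 < ν → HasFirstSingularity ν T u p →
    ∃ (x : ℕ → E3) (t R : ℕ → ℝ) (U : ℝ → E3 → E3),
      IsTerminalSequence K T u x t R ∧ Tendsto R atTop (𝓝 0) ∧ Tendsto t atTop (𝓝 T) ∧
      IsEndpointOf u x t R U ∧ IsNonzeroAncient U

/-- **Theorem 11.2 — terminal ledger exhaustion** (l.1702–1708, p.40; proof l.1709–1711 by Thm 5.4, Thm 10.6,
Thm 8.1, Thms 10.7/10.8/10.18, Thm 9.17, Cor 9.15, Lemma 9.18; Lemma 11.1 p.39 "No fourth alternative is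
possible without producing one of the ledger outputs"): "Let `Q_k` be a terminal singularity-forcing sequence
with all named outputs and strict active descendants absent. Then every nonzero terminal endpoint selected
from `Q_k` is either a flat two-dimensional endpoint or an axisymmetric-with-swirl endpoint."
[claim: Shahmurov2026, status: under-review] -/
def Step_T112 (K : Ledger) : Prop :=
  ∀ (ν T : ℝ) (u : ℝ → E3 → E3) (p : ℝ → E3 → ℝ), 0 < ν → IsSmoothFiniteEnergySolutionOn ν T u p →
    ∀ (x : ℕ → E3) (t R : ℕ → ℝ) (U : ℝ → E3 → E3),
      IsTerminalSequence K T u x t R → IsEndpointOf u x t R U → IsNonzeroAncient U →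
      IsFlatTwoDimensionalOn (Iio 0) U ∨ IsAxisymmetricFlowOn (Iio 0) U

/-- **The flat branch** (l.1710 "The flat class is regular"; l.1715 "The flat two-dimensional endpoint is
regular by the classical two-dimensional theory"; proof of Thm 2.2 l.1714 "The flat endpoint is regular" —
used to DISCARD the flat alternative for an endpoint of a first singularity): a nonzero endpoint of a terminal
singularity-forcing sequence of a first singularity is not flat two-dimensional. (Typed as the exclusion the
proof uses; the print's word is "regular".) [claim: Shahmurov2026, status: under-review] -/
def Step_flat (K : Ledger) : Prop :=
  ∀ (ν T : ℝ) (u : ℝ → E3 → E3) (p : ℝ → E3 → ℝ), 0 < ν → HasFirstSingularity ν T u p →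
    ∀ (x : ℕ → E3) (t R : ℕ → ℝ) (U : ℝ → E3 → E3),
      IsTerminalSequence K T u x t R → IsEndpointOf u x t R U → IsNonzeroAncient U →
      ¬ IsFlatTwoDimensionalOn (Iio 0) U

/-- **Theorem 2.2 as it is used** (l.239–241 with l.1712–1714): a first singularity of a smooth
finite-energy solution produces a nonzero endpoint of a terminal singularity-forcing zero-output sequence
(shrinking to the singular time) which is axisymmetric about a fixed axis ("a normalized terminal
first-threshold endpoint in the axisymmetric-with-swirl class"). [claim: Shahmurov2026, status: under-review] -/
def Thm22 (K : Ledger) : Prop :=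
  ∀ (ν T : ℝ) (u : ℝ → E3 → E3) (p : ℝ → E3 → ℝ), 0 < ν → HasFirstSingularity ν T u p →
    ∃ (x : ℕ → E3) (t R : ℕ → ℝ) (U : ℝ → E3 → E3),
      IsTerminalSequence K T u x t R ∧ Tendsto R atTop (𝓝 0) ∧ Tendsto t atTop (𝓝 T) ∧
      IsEndpointOf u x t R U ∧ IsNonzeroAncient U ∧ IsAxisymmetricFlowOn (Iio 0) U

/-- **Proof of Corollary 2.3, the load-bearing sentence** (l.1716–1718, p.40): "If the axisymmetric-with-swirl
class is globally regular, Theorem 2.2 excludes the only possible terminal singular endpoint of a general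
three-dimensional solution" — i.e. UNDER (AS) no first singularity can have a nonzero axisymmetric terminal
endpoint. ((AS) speaks of smooth finite-energy axisymmetric SOLUTIONS; the endpoint is an ancient
local-energy PROFILE — interface item F2; typed as the implication used.) [claim: Shahmurov2026, status: under-review] -/
def Step_Cor23 (K : Ledger) : Prop :=
  ∀ ν : ℝ, 0 < ν → StatementAS ν →
    ∀ (T : ℝ) (u : ℝ → E3 → E3) (p : ℝ → E3 → ℝ), HasFirstSingularity ν T u p →
      ∀ (x : ℕ → E3) (t R : ℕ → ℝ) (U : ℝ → E3 → E3),
        IsTerminalSequence K T u x t R → IsEndpointOf u x t R U → IsNonzeroAncient U →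
        IsAxisymmetricFlowOn (Iio 0) U → False

/-- **The companion ENDPOINT theorem, as RED's Cor 12.5 consumes it** (l.1817–1823, p.44: "Assume the companion
axisymmetric-with-swirl endpoint theorem excludes all first-threshold axisymmetric-with-swirl singular endpoints
satisfying the hypotheses in Theorem 12.4"; AX Thm l.6314–6321 + Cor l.6323–6329 assert AX delivers it): no
first singularity at viscosity `ν` has a nonzero axisymmetric endpoint of a terminal singularity-forcing
zero-output sequence. (Thm 12.4's "admissible input" package — `Γ = ru^θ`, `q = ω^θ`, `G = q/r`
axis-compatible, locally finite critical scores — is prose; folded into "endpoint of a terminal sequence".)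
[claim: Shahmurov2026Axisym, status: under-review] -/
def EndpointExclusionAX (K : Ledger) (ν : ℝ) : Prop :=
  ∀ (T : ℝ) (u : ℝ → E3 → E3) (p : ℝ → E3 → ℝ), HasFirstSingularity ν T u p →
    ∀ (x : ℕ → E3) (t R : ℕ → ℝ) (U : ℝ → E3 → E3),
      IsTerminalSequence K T u x t R → IsEndpointOf u x t R U → IsNonzeroAncient U →
      IsAxisymmetricFlowOn (Iio 0) U → False

/-- **The imported endpoint step** (AX "master endpoint theorem" l.7943 ff. via AX Thm l.6314–6321 / Cor
l.6323–6329; RED Thm 12.4 p.43): for every `ν > 0` the companion excludes the axisymmetric endpoints. ONE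
black-box Step per the lead's ruling. [claim: Shahmurov2026Axisym, status: under-review] -/
def Step_AXendpoint (K : Ledger) : Prop :=
  ∀ ν : ℝ, 0 < ν → EndpointExclusionAX K ν

/-! ## E. Compositions (pure logic) -/

/-- **Theorem 2.2 from its steps** (proof l.1712–1714): selection ⇒ terminal zero-output sequence with a
nonzero endpoint; Thm 11.2 ⇒ flat 2D or axisymmetric; the flat branch is discarded. Pure logic.
[cite: Shahmurov2026, proof of Thm 2.2 l.1712–1714 (p.40)] -/
theorem thm22_of_steps (K : Ledger) (hsel : Step_selection K) (h112 : Step_T112 K) (hflat : Step_flat K) :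
    Thm22 K := by
  intro ν T u p hν hsing
  obtain ⟨x, t, R, U, hterm, hR, ht, hend, hnz⟩ := hsel ν T u p hν hsing
  refine ⟨x, t, R, U, hterm, hR, ht, hend, hnz, ?_⟩
  rcases h112 ν T u p hν hsing.2.1 x t R U hterm hend hnz with hfl | hax
  · exact absurd hfl (hflat ν T u p hν hsing x t R U hterm hend hnz)
  · exact hax

/-- **Corollary 2.3 from Theorem 2.2** (proof l.1716–1718): (AS) ⇒ (G), through `Step_Cor23`. Pure logic.
[cite: Shahmurov2026, proof of Cor 2.3 l.1716–1718 (p.40)] -/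
theorem cor23_of_steps (K : Ledger) (h22 : Thm22 K) (hcor : Step_Cor23 K) {ν : ℝ} (hν : 0 < ν)
    (hAS : StatementAS ν) : StatementG ν := by
  intro T u p hT hsol
  by_contra hext
  have hsing : HasFirstSingularity ν T u p := ⟨hT, hsol, hext⟩
  obtain ⟨x, t, R, U, hterm, -, -, hend, hnz, hax⟩ := h22 ν T u p hν hsing
  exact hcor ν hν hAS T u p hsing x t R U hterm hend hnz hax

/-- **Corollary 12.5 from Theorem 2.2** (proof l.1821–1823, p.44): the companion endpoint theorem ⇒ no first
singularity, i.e. (G). Pure logic. [cite: Shahmurov2026, Cor 12.5 l.1817–1823 (p.44)] -/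
theorem cor125_of_steps (K : Ledger) (h22 : Thm22 K) {ν : ℝ} (hν : 0 < ν)
    (hAX : EndpointExclusionAX K ν) : StatementG ν := by
  intro T u p hT hsol
  by_contra hext
  have hsing : HasFirstSingularity ν T u p := ⟨hT, hsol, hext⟩
  obtain ⟨x, t, R, U, hterm, -, -, hend, hnz, hax⟩ := h22 ν T u p hν hsing
  exact hAX T u p hsing x t R U hterm hend hnz hax

/-- **COMPOSITION, route of record** (the papers' own interface, RED §12 Cor 12.5 + AX Cor l.6323–6329):
selection, terminal ledger exhaustion, the flat branch and the companion endpoint theorem imply (G) for every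
`ν > 0`. Pure logic. [claim: Shahmurov2026, status: under-review] -/
theorem claim_of_steps (K : Ledger) (hsel : Step_selection K) (h112 : Step_T112 K) (hflat : Step_flat K)
    (hAX : Step_AXendpoint K) : ClaimedTheorem :=
  fun ν hν => cor125_of_steps K (thm22_of_steps K hsel h112 hflat) hν (hAX ν hν)

/-- **COMPOSITION, Definition 2.1 route** (Cor 2.3 with (AS) supplied by AX Thm 1.1 through the interface
step): pure logic. [claim: Shahmurov2026, status: under-review] -/
theorem claim_of_steps_def21 (K : Ledger) (hsel : Step_selection K) (h112 : Step_T112 K)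
    (hflat : Step_flat K) (hcor : Step_Cor23 K) (hAX : Step_AX11) (hint : Step_AS_of_AX) :
    ClaimedTheorem :=
  fun ν hν => cor23_of_steps K (thm22_of_steps K hsel h112 hflat) hcor hν (hint hAX ν hν)

/-- (G) implies (AS) trivially (the converse direction of Cor 2.3, l.245: "any axisymmetric-with-swirl
counterexample is automatically a three-dimensional counterexample"). [cite: Shahmurov2026, Cor 2.3 l.243–245 (p.7)] -/
theorem statementAS_of_statementG {ν : ℝ} (h : StatementG ν) : StatementAS ν :=
  fun T u p hT hsol _ => h T u p hT hsol


/-! ## F. Rev 2 (append-only): the SELECTION step split at the referee's pre-registered grain (RETYPE.md v0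
§1 F2/F5: "the existence of the endpoint (compactness — Thm 10.19 p.39) typed as a hypothesis or a Step, not
folded into the conclusion"; "the composition must consume a typed «terminality» hypothesis that the proof of
Thm 2.2 p.40 discharges by the selection sentence") — `Step_selection K` is the conjunction of three printed
claims, typed separately below and re-assembled by `selection_of_parts` (pure logic). -/

/-- **Terminal choice** (proof of Thm 2.2 l.1712–1714: "choose the terminal sequence so that every visible
output and active descendant has been either selected or exhausted by the finite-overlap stopping order. If a
non-axisymmetric output or descendant remained, the terminal sequence would not be terminal"; Thm 10.18 p.38
well-founded selected-output rank; Lemma 3.6 p.8 "one may choose a terminal sequence by the lexicographic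
order"): a first singularity admits a terminal singularity-forcing sequence with all outputs and strict
descendants absent, shrinking to the singular time. [claim: Shahmurov2026, status: under-review] -/
def Step_terminalChoice (K : Ledger) : Prop :=
  ∀ (ν T : ℝ) (u : ℝ → E3 → E3) (p : ℝ → E3 → ℝ), 0 < ν → HasFirstSingularity ν T u p →
    ∃ (x : ℕ → E3) (t R : ℕ → ℝ),
      IsTerminalSequence K T u x t R ∧ Tendsto R atTop (𝓝 0) ∧ Tendsto t atTop (𝓝 T)

/-- **Endpoint compactness** (Thm 10.19 p.39 "selected-output profile compactness"; Thm 2.2 "after parabolic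
rescaling around a singularity-forcing packet"; Remark 10.20 "classical compactness alternatives"): every
terminal singularity-forcing sequence of a smooth finite-energy solution has an endpoint (a subsequential
`L²_loc` limit of the rescaled fields). [claim: Shahmurov2026, status: under-review] -/
def Step_compactness (K : Ledger) : Prop :=
  ∀ (ν T : ℝ) (u : ℝ → E3 → E3) (p : ℝ → E3 → ℝ), 0 < ν → IsSmoothFiniteEnergySolutionOn ν T u p →
    ∀ (x : ℕ → E3) (t R : ℕ → ℝ), IsTerminalSequence K T u x t R → Tendsto R atTop (𝓝 0) →
      ∃ U : ℝ → E3 → E3, IsEndpointOf u x t R U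

/-- **Endpoint nontriviality** (Lemma 3.6 proof l.306: "Since the final terminal packet is selected at the
regularity threshold, the endpoint produced by this construction is singularity-forcing rather than merely
warning-level active"; Thm 3.3 proof l.279: the instantaneous score term "is retained for compactness and lower
semicontinuity in the terminal selection"; Thm 11.2 speaks of "every NONZERO terminal endpoint"): an endpoint
of a terminal singularity-forcing sequence (scores `≥ e_sing`) is nonzero. [claim: Shahmurov2026, status: under-review] -/
def Step_nonzero (K : Ledger) : Prop :=
  ∀ (ν T : ℝ) (u : ℝ → E3 → E3) (p : ℝ → E3 → ℝ), 0 < ν → IsSmoothFiniteEnergySolutionOn ν T u p →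
    ∀ (x : ℕ → E3) (t R : ℕ → ℝ) (U : ℝ → E3 → E3), IsTerminalSequence K T u x t R →
      Tendsto R atTop (𝓝 0) → IsEndpointOf u x t R U → IsNonzeroAncient U

/-- **`Step_selection` from its three printed parts** (terminal choice, compactness, nontriviality). Pure
logic. [cite: Shahmurov2026, proof of Thm 2.2 l.1712–1714 (p.40)] -/
theorem selection_of_parts (K : Ledger) (htc : Step_terminalChoice K) (hcp : Step_compactness K)
    (hnz : Step_nonzero K) : Step_selection K := by
  intro ν T u p hν hsing
  obtain ⟨x, t, R, hterm, hR, ht⟩ := htc ν T u p hν hsing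
  obtain ⟨U, hend⟩ := hcp ν T u p hν hsing.2.1 x t R hterm hR
  exact ⟨x, t, R, U, hterm, hR, ht, hend, hnz ν T u p hν hsing.2.1 x t R U hterm hR hend⟩

/-- **COMPOSITION at the referee's grain, route of record** (§12): terminal choice, compactness,
nontriviality, Thm 11.2, the flat branch and the companion endpoint theorem imply (G) for every `ν > 0`. Pure
logic. [claim: Shahmurov2026, status: under-review] -/
theorem claim_of_steps₂ (K : Ledger) (htc : Step_terminalChoice K) (hcp : Step_compactness K)
    (hnz : Step_nonzero K) (h112 : Step_T112 K) (hflat : Step_flat K) (hAX : Step_AXendpoint K) :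
    ClaimedTheorem :=
  claim_of_steps K (selection_of_parts K htc hcp hnz) h112 hflat hAX

/-- **COMPOSITION at the referee's grain, Definition 2.1 route.** Pure logic.
[claim: Shahmurov2026, status: under-review] -/
theorem claim_of_steps_def21₂ (K : Ledger) (htc : Step_terminalChoice K) (hcp : Step_compactness K)
    (hnz : Step_nonzero K) (h112 : Step_T112 K) (hflat : Step_flat K) (hcor : Step_Cor23 K)
    (hAX : Step_AX11) (hint : Step_AS_of_AX) : ClaimedTheorem :=
  claim_of_steps_def21 K (selection_of_parts K htc hcp hnz) h112 hflat hcor hAX hint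

/-! ## G. Discharge (append-only; D-0026 debt pass, ns-claims-typist-7 g5, 2026-08-27): Lemma 9.18 in the
referee's charitable `L²` form (`Step_L918_L2`, RETYPE.md §2 R#a) is a THEOREM — `step_L918_L2_holds`. Nothing
above is changed; no statement, locator, class or token of #24 is touched (`Step_L918_L2` is not the locator).
Route (tree only): for each `θ` the difference `w = R_{−θ} ∘ v ∘ R_θ − v` is `C¹`, square-integrable
(`LinearIsometryEquiv.measurePreserving`, `ContinuousLinearMap.comp_memLp'`), divergence free
(`VectorCalculus.IsDivFree.conj_linearIsometryEquiv`, `IsometryInvariance.lean`) and irrotational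
(`curlCLM_rotZL_conj`, `AxisymmetricVorticityTransport.lean`, with the hypothesis); its coordinates are weakly
harmonic by three boundary-free integrations by parts (`integral_inner_laplacian_add_eq_zero`,
`integral_fderiv_apply_eq_zero` of `WholeSpaceIBP.lean`; Schwarz `fderiv_fderiv_apply_comm`; symmetric Jacobian
`apply_single_comm_of_curlCLM_eq_zero` of `CurlFreeLiouville.lean`), hence harmonic by the tree's Weyl lemma
(`harmonicOnNhd_of_continuousOn_of_weaklyHarmonic`, `HarmonicOfSmallStencil.lean`), hence zero by the `L²`
Liouville theorem (`eq_zero_of_harmonic_memLp`, `HarmonicLiouvilleLp.lean`). -/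

section L918

open _root_.InnerProductSpace _root_.Function
open scoped Laplacian ContDiff RealInnerProductSpace

/-- Coordinates of the derivative: `∂ₕ (x ↦ w(x)ᵢ) = (∂ₕ w(x))ᵢ`. [folklore] -/
private theorem fderiv_coord_apply {w : E3 → E3} (hw : Differentiable ℝ w) (x h : E3) (i : Fin 3) :
    fderiv ℝ (fun y => w y i) x h = fderiv ℝ w x h i := by
  have e1 : (fun y => w y i) = (EuclideanSpace.proj i : E3 →L[ℝ] ℝ) ∘ w := by
    funext y; rfl
  rw [e1, fderiv_comp x (EuclideanSpace.proj i : E3 →L[ℝ] ℝ).differentiableAt (hw x),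
    ContinuousLinearMap.fderiv, ContinuousLinearMap.comp_apply]
  rfl

/-- A coordinate of a `C¹` field is `C¹`. [folklore] -/
private theorem contDiff_coord {w : E3 → E3} {n : WithTop ℕ∞} (hw : ContDiff ℝ n w) (i : Fin 3) :
    ContDiff ℝ n (fun y => w y i) :=
  (EuclideanSpace.proj i : E3 →L[ℝ] ℝ).contDiff.comp hw

/-- The divergence in standard coordinates: `div w (x) = Σⱼ (∂ⱼ w(x))ⱼ`. [folklore] -/
private theorem divergence_eq_sum_coord (w : E3 → E3) (x : E3) :
    VectorCalculus.divergence w x = ∑ j, fderiv ℝ w x (EuclideanSpace.single j (1 : ℝ)) j := by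
  rw [divergence_eq_sum_inner_fderiv (EuclideanSpace.basisFun (Fin 3) ℝ)]
  refine Finset.sum_congr rfl fun j _ => ?_
  rw [EuclideanSpace.basisFun_apply, EuclideanSpace.inner_single_left]
  simp

/-- **Weak harmonicity of the coordinates of a `C¹` irrotational incompressible field.** If
`w ∈ C¹(ℝ³; ℝ³)` has `curl w = 0` and `div w = 0`, then `∫ wᵢ Δφ = 0` for every smooth compactly
supported `φ` and every `i` (three boundary-free integrations by parts: `∫ wᵢ Δφ = −Σⱼ∫ ∂ⱼφ ∂ⱼwᵢ
= −Σⱼ∫ ∂ⱼφ ∂ᵢwⱼ = Σⱼ∫ ∂ᵢ∂ⱼφ wⱼ = Σⱼ∫ ∂ⱼ(∂ᵢφ) wⱼ = −∫ ∂ᵢφ div w = 0`). [folklore] -/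
private theorem integral_coord_mul_laplacian_eq_zero {w : E3 → E3} (hw : ContDiff ℝ 1 w)
    (hcurl : ∀ x, curl w x = 0) (hdiv : VectorCalculus.IsDivFree w) {φ : E3 → ℝ}
    (hφ : ContDiff ℝ ∞ φ) (hφc : HasCompactSupport φ) (i : Fin 3) :
    ∫ x, w x i * (Δ φ) x = 0 := by
  set b : OrthonormalBasis (Fin 3) ℝ E3 := EuclideanSpace.basisFun (Fin 3) ℝ with hb
  have hbj : ∀ j, b j = EuclideanSpace.single j (1 : ℝ) := fun j => by rw [hb, EuclideanSpace.basisFun_apply]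
  have hφ2 : ContDiff ℝ 2 φ := hφ.of_le (by norm_cast)
  have hwd : Differentiable ℝ w := hw.differentiable one_ne_zero
  have hwi : ContDiff ℝ 1 (fun y => w y i) := contDiff_coord hw i
  -- continuity facts
  have hcw : Continuous w := hw.continuous
  have hcwj : ∀ j, Continuous fun x => w x j := fun j => (contDiff_coord hw j).continuous
  have hcDw : Continuous (fderiv ℝ w) := hw.continuous_fderiv one_ne_zero
  have hcDwc : ∀ h : E3, ∀ j, Continuous fun x => fderiv ℝ w x h j := fun h j =>
    (EuclideanSpace.proj j : E3 →L[ℝ] ℝ).continuous.comp (hcDw.clm_apply continuous_const)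
  have hcDφ : ∀ h : E3, Continuous fun x => fderiv ℝ φ x h := fun h =>
    (hφ.continuous_fderiv (by simp)).clm_apply continuous_const
  -- the first partials of `φ` are smooth with compact support
  have hDφ : ∀ h : E3, ContDiff ℝ ∞ fun x => fderiv ℝ φ x h := fun h =>
    (hφ.fderiv_right (m := ∞) (by simp)).clm_apply contDiff_const
  have hDφc : ∀ h : E3, HasCompactSupport fun x => fderiv ℝ φ x h := fun h =>
    hφc.fderiv_apply (𝕜 := ℝ) h
  have hcDDφ : ∀ h k : E3, Continuous fun x => fderiv ℝ (fun y => fderiv ℝ φ y h) x k :=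
    fun h k => ((hDφ h).continuous_fderiv (by simp)).clm_apply continuous_const
  -- Step 1: Green without boundary, scalar case
  have h1 := integral_inner_laplacian_add_eq_zero b (v := φ) (w := fun y => w y i) hφ2 hwi
    (Or.inl hφc)
  have h1' : ∫ x, w x i * (Δ φ) x =
      -∑ j, ∫ x, fderiv ℝ φ x (EuclideanSpace.single j (1 : ℝ)) * fderiv ℝ w x (EuclideanSpace.single j (1 : ℝ)) i := by
    have e0 : (fun x => ⟪(Δ φ) x, w x i⟫) = fun x => w x i * (Δ φ) x := by
      funext x; simp
    have e1 : ∀ j, (fun x => ⟪fderiv ℝ φ x (b j), fderiv ℝ (fun y => w y i) x (b j)⟫) =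
        fun x => fderiv ℝ φ x (EuclideanSpace.single j (1 : ℝ)) * fderiv ℝ w x (EuclideanSpace.single j (1 : ℝ)) i := by
      intro j; funext x
      rw [hbj, fderiv_coord_apply hwd]
      simp [mul_comm]
    rw [e0] at h1
    simp_rw [e1] at h1
    linarith
  -- Step 2: symmetric Jacobian (curl w = 0): `(∂ⱼw)ᵢ = (∂ᵢw)ⱼ`
  have h2 : ∀ x j, fderiv ℝ w x (EuclideanSpace.single j (1 : ℝ)) i = fderiv ℝ w x (EuclideanSpace.single i (1 : ℝ)) j := fun x j => by
    have h0 : curlCLM (fderiv ℝ w x) = 0 := by rw [← curl_eq_curlCLM]; exact hcurl x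
    exact apply_single_comm_of_curlCLM_eq_zero h0 i j
  -- Step 3: move `∂ᵢ` from `wⱼ` onto `∂ⱼφ`
  have h3 : ∀ j, ∫ x, fderiv ℝ φ x (EuclideanSpace.single j (1 : ℝ)) * fderiv ℝ w x (EuclideanSpace.single i (1 : ℝ)) j =
      -∫ x, fderiv ℝ (fun y => fderiv ℝ φ y (EuclideanSpace.single j (1 : ℝ))) x (EuclideanSpace.single i (1 : ℝ)) * w x j := by
    intro j
    -- `hⱼ = ∂ⱼφ · wⱼ ∈ C¹_c`
    have hH : ContDiff ℝ 1 fun x => fderiv ℝ φ x (EuclideanSpace.single j (1 : ℝ)) * w x j :=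
      ((hDφ (EuclideanSpace.single j (1 : ℝ))).of_le (by norm_cast)).mul (contDiff_coord hw j)
    have hHc : HasCompactSupport fun x => fderiv ℝ φ x (EuclideanSpace.single j (1 : ℝ)) * w x j :=
      (hDφc (EuclideanSpace.single j (1 : ℝ))).mul_right
    have hint := integral_fderiv_apply_eq_zero hH hHc (EuclideanSpace.single i (1 : ℝ))
    have hderiv : ∀ x, fderiv ℝ (fun x => fderiv ℝ φ x (EuclideanSpace.single j (1 : ℝ)) * w x j) x (EuclideanSpace.single i (1 : ℝ)) =
        fderiv ℝ (fun y => fderiv ℝ φ y (EuclideanSpace.single j (1 : ℝ))) x (EuclideanSpace.single i (1 : ℝ)) * w x j +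
          fderiv ℝ φ x (EuclideanSpace.single j (1 : ℝ)) * fderiv ℝ w x (EuclideanSpace.single i (1 : ℝ)) j := by
      intro x
      have hd1 : DifferentiableAt ℝ (fun y => fderiv ℝ φ y (EuclideanSpace.single j (1 : ℝ))) x :=
        ((hDφ (EuclideanSpace.single j (1 : ℝ))).differentiable (by simp)) x
      have hd2 : DifferentiableAt ℝ (fun y => w y j) x :=
        ((contDiff_coord hw j).differentiable one_ne_zero) x
      rw [fderiv_fun_mul hd1 hd2]
      simp only [FunLike.coe_add, FunLike.coe_smul, Pi.add_apply, Pi.smul_apply, smul_eq_mul]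
      rw [fderiv_coord_apply hwd]
      ring
    simp_rw [hderiv] at hint
    have hi1 : Integrable (fun x => fderiv ℝ (fun y => fderiv ℝ φ y (EuclideanSpace.single j (1 : ℝ))) x (EuclideanSpace.single i (1 : ℝ)) * w x j) :=
      ((hcDDφ (EuclideanSpace.single j (1 : ℝ)) (EuclideanSpace.single i (1 : ℝ))).mul (hcwj j)).integrable_of_hasCompactSupport
        ((hDφc (EuclideanSpace.single j (1 : ℝ))).fderiv_apply (𝕜 := ℝ) (EuclideanSpace.single i (1 : ℝ))).mul_right
    have hi2 : Integrable (fun x => fderiv ℝ φ x (EuclideanSpace.single j (1 : ℝ)) * fderiv ℝ w x (EuclideanSpace.single i (1 : ℝ)) j) :=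
      ((hcDφ (EuclideanSpace.single j (1 : ℝ))).mul (hcDwc (EuclideanSpace.single i (1 : ℝ)) j)).integrable_of_hasCompactSupport (hDφc (EuclideanSpace.single j (1 : ℝ))).mul_right
    rw [integral_add hi1 hi2] at hint
    linarith
  -- Step 4: Schwarz for `φ`: `∂ᵢ∂ⱼφ = ∂ⱼ∂ᵢφ`
  have h4 : ∀ x j, fderiv ℝ (fun y => fderiv ℝ φ y (EuclideanSpace.single j (1 : ℝ))) x (EuclideanSpace.single i (1 : ℝ)) =
      fderiv ℝ (fun y => fderiv ℝ φ y (EuclideanSpace.single i (1 : ℝ))) x (EuclideanSpace.single j (1 : ℝ)) := fun x j =>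
    fderiv_fderiv_apply_comm hφ2 x (EuclideanSpace.single i (1 : ℝ)) (EuclideanSpace.single j (1 : ℝ))
  -- Step 5: move `∂ⱼ` from `ψ = ∂ᵢφ` onto `wⱼ`
  set ψ : E3 → ℝ := fun y => fderiv ℝ φ y (EuclideanSpace.single i (1 : ℝ)) with hψ
  have h5 : ∀ j, ∫ x, fderiv ℝ ψ x (EuclideanSpace.single j (1 : ℝ)) * w x j = -∫ x, ψ x * fderiv ℝ w x (EuclideanSpace.single j (1 : ℝ)) j := by
    intro j
    have hK : ContDiff ℝ 1 fun x => ψ x * w x j :=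
      ((hDφ (EuclideanSpace.single i (1 : ℝ))).of_le (by norm_cast)).mul (contDiff_coord hw j)
    have hKc : HasCompactSupport fun x => ψ x * w x j := (hDφc (EuclideanSpace.single i (1 : ℝ))).mul_right
    have hint := integral_fderiv_apply_eq_zero hK hKc (EuclideanSpace.single j (1 : ℝ))
    have hderiv : ∀ x, fderiv ℝ (fun x => ψ x * w x j) x (EuclideanSpace.single j (1 : ℝ)) =
        fderiv ℝ ψ x (EuclideanSpace.single j (1 : ℝ)) * w x j + ψ x * fderiv ℝ w x (EuclideanSpace.single j (1 : ℝ)) j := by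
      intro x
      have hd1 : DifferentiableAt ℝ ψ x := ((hDφ (EuclideanSpace.single i (1 : ℝ))).differentiable (by simp)) x
      have hd2 : DifferentiableAt ℝ (fun y => w y j) x :=
        ((contDiff_coord hw j).differentiable one_ne_zero) x
      rw [fderiv_fun_mul hd1 hd2]
      simp only [FunLike.coe_add, FunLike.coe_smul, Pi.add_apply, Pi.smul_apply, smul_eq_mul]
      rw [fderiv_coord_apply hwd]
      ring
    simp_rw [hderiv] at hint
    have hi1 : Integrable (fun x => fderiv ℝ ψ x (EuclideanSpace.single j (1 : ℝ)) * w x j) :=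
      ((hcDDφ (EuclideanSpace.single i (1 : ℝ)) (EuclideanSpace.single j (1 : ℝ))).mul (hcwj j)).integrable_of_hasCompactSupport
        ((hDφc (EuclideanSpace.single i (1 : ℝ))).fderiv_apply (𝕜 := ℝ) (EuclideanSpace.single j (1 : ℝ))).mul_right
    have hi2 : Integrable (fun x => ψ x * fderiv ℝ w x (EuclideanSpace.single j (1 : ℝ)) j) :=
      ((hcDφ (EuclideanSpace.single i (1 : ℝ))).mul (hcDwc (EuclideanSpace.single j (1 : ℝ)) j)).integrable_of_hasCompactSupport (hDφc (EuclideanSpace.single i (1 : ℝ))).mul_right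
    rw [integral_add hi1 hi2] at hint
    linarith
  -- Step 6: `Σⱼ ∫ ψ ∂ⱼwⱼ = ∫ ψ div w = 0`
  have h6 : ∑ j, ∫ x, ψ x * fderiv ℝ w x (EuclideanSpace.single j (1 : ℝ)) j = 0 := by
    have hi : ∀ j, Integrable (fun x => ψ x * fderiv ℝ w x (EuclideanSpace.single j (1 : ℝ)) j) := fun j =>
      ((hcDφ (EuclideanSpace.single i (1 : ℝ))).mul (hcDwc (EuclideanSpace.single j (1 : ℝ)) j)).integrable_of_hasCompactSupport (hDφc (EuclideanSpace.single i (1 : ℝ))).mul_right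
    rw [← integral_finsetSum _ fun j _ => hi j]
    have : (fun x => ∑ j, ψ x * fderiv ℝ w x (EuclideanSpace.single j (1 : ℝ)) j) = fun _ => (0 : ℝ) := by
      funext x
      rw [← Finset.mul_sum, ← divergence_eq_sum_coord, hdiv x, mul_zero]
    rw [this, integral_zero]
  -- assemble
  rw [h1']
  simp_rw [h2, h3, h4]
  have : ∑ j, -∫ x, fderiv ℝ (fun y => fderiv ℝ φ y (EuclideanSpace.single i (1 : ℝ))) x (EuclideanSpace.single j (1 : ℝ)) * w x j =
      ∑ j, ∫ x, ψ x * fderiv ℝ w x (EuclideanSpace.single j (1 : ℝ)) j := by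
    refine Finset.sum_congr rfl fun j _ => ?_
    rw [h5 j, neg_neg]
  rw [this, h6, neg_zero]

/-- **Liouville for `C¹` irrotational incompressible `L²` fields on `ℝ³`.** A `C¹` field with
`curl w = 0`, `div w = 0` and `w ∈ L²(ℝ³)` vanishes identically: its coordinates are continuous and
weakly harmonic (`integral_coord_mul_laplacian_eq_zero`), hence harmonic (Weyl's lemma,
`harmonicOnNhd_of_continuousOn_of_weaklyHarmonic`), hence zero (`eq_zero_of_harmonic_memLp`).
[folklore] -/
private theorem eq_zero_of_curl_eq_zero_of_isDivFree_of_memLp {w : E3 → E3} (hw : ContDiff ℝ 1 w)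
    (hcurl : ∀ x, curl w x = 0) (hdiv : VectorCalculus.IsDivFree w)
    (hL2 : MemLp w 2 (volume : Measure E3)) : w = 0 := by
  have hcoord : ∀ i : Fin 3, (fun x => w x i) = 0 := by
    intro i
    have hcont : Continuous fun x => w x i := (contDiff_coord hw i).continuous
    have hharm : HarmonicOnNhd (fun x => w x i) univ :=
      harmonicOnNhd_of_continuousOn_of_weaklyHarmonic isOpen_univ hcont.continuousOn
        fun φ hφ hφc _ => integral_coord_mul_laplacian_eq_zero hw hcurl hdiv hφ hφc i
    have hmem : MemLp (fun x => w x i) 2 (volume : Measure E3) :=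
      (EuclideanSpace.proj i : E3 →L[ℝ] ℝ).comp_memLp' hL2
    exact eq_zero_of_harmonic_memLp hharm (q := 2) (by norm_num) (by simp) hmem
  funext x
  ext i
  exact congrFun (hcoord i) x

/-- `curl` of a difference of differentiable fields. [folklore] -/
private theorem curl_sub' {f g : E3 → E3} (hf : Differentiable ℝ f) (hg : Differentiable ℝ g)
    (x : E3) : curl (fun y => f y - g y) x = curl f x - curl g x := by
  rw [curl_eq_curlCLM, curl_eq_curlCLM, curl_eq_curlCLM,
    fderiv_fun_sub (hf x) (hg x), map_sub]

/-- `div` of a difference of differentiable fields. [folklore] -/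
private theorem divergence_sub' {f g : E3 → E3} (hf : Differentiable ℝ f) (hg : Differentiable ℝ g)
    (x : E3) : VectorCalculus.divergence (fun y => f y - g y) x =
      VectorCalculus.divergence f x - VectorCalculus.divergence g x := by
  simp only [VectorCalculus.divergence]
  rw [fderiv_fun_sub (hf x) (hg x)]
  simp

/-- The curl of the conjugated field `R_{−θ} ∘ v ∘ R_θ`: `curl(R_{−θ} v R_θ)(x) = R_{−θ} (curl v)(R_θ x)`
(`curlCLM_rotZL_conj` applied to `D(R_{−θ} v R_θ)(x) = R_{−θ} ∘ Dv(R_θ x) ∘ R_θ`). [folklore] -/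
private theorem curl_rotZ_neg_conj {v : E3 → E3} (hv : Differentiable ℝ v) (θ : ℝ) (x : E3) :
    curl (fun z => rotZ (-θ) (v (rotZ θ z))) x = rotZ (-θ) (curl v (rotZ θ x)) := by
  have e : (fun z => rotZ (-θ) (v (rotZ θ z))) = (rotZL (-θ)) ∘ v ∘ (rotZL θ) := by
    funext z; simp [Function.comp]
  have h1 : DifferentiableAt ℝ (v ∘ (rotZL θ)) x := (hv _).comp x (rotZL θ).differentiableAt
  have hd : fderiv ℝ (fun z => rotZ (-θ) (v (rotZ θ z))) x =
      (rotZL (-θ)).comp ((fderiv ℝ v (rotZ θ x)).comp (rotZL (- -θ))) := by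
    rw [neg_neg, e, fderiv_comp x (rotZL (-θ)).differentiableAt h1, ContinuousLinearMap.fderiv,
      fderiv_comp x (hv _) (rotZL θ).differentiableAt, ContinuousLinearMap.fderiv]
    rfl
  rw [curl_eq_curlCLM, hd, curlCLM_rotZL_conj, ← curl_eq_curlCLM]

/-- **Lemma 9.18 in the referee's charitable `L²` form holds** (RETYPE.md §2 R#a; print l.1144–1150
p.27): a `C¹`, square-integrable, divergence-free field on `ℝ³` whose vorticity is equivariant under
all rotations about the `x₂`-axis is axisymmetric. Proof: for each `θ` the field
`w = R_{−θ} ∘ v ∘ R_θ − v` is `C¹`, in `L²` (rotations preserve Lebesgue measure and norms),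
divergence free (`VectorCalculus.IsDivFree.conj_linearIsometryEquiv`) and irrotational
(`curlCLM_rotZL_conj` with the hypothesis), so `w = 0` by
`eq_zero_of_curl_eq_zero_of_isDivFree_of_memLp` (Biot–Savart uniqueness in `L²`), i.e.
`v ∘ R_θ = R_θ ∘ v`. Net effect on the record: the charitable Lemma 9.18 is a theorem; locator
`Step_terminalChoice` / class of #24 untouched. [cite: Shahmurov2026, Lemma 9.18 l.1144–1150 (p.27)] -/
theorem step_L918_L2_holds : Step_L918_L2 := by
  intro v hv hL2 hdiv hcurl θ x
  have hvd : Differentiable ℝ v := hv.differentiable one_ne_zero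
  -- the rotation `R = R_{−θ}` as a linear isometry equivalence, `R⁻¹ = R_θ`
  set R : E3 ≃ₗᵢ[ℝ] E3 := (rotZLIE θ).symm with hR
  have hRa : ∀ y, R y = rotZ (-θ) y := fun y => rfl
  have hRs : ∀ y, R.symm y = rotZ θ y := fun y => rfl
  -- the conjugated field and the difference field
  set u : E3 → E3 := fun y => rotZ (-θ) (v (rotZ θ y)) with hu
  have hu' : u = fun y => R (v (R.symm y)) := by funext y; rw [hRa, hRs]
  have hu1 : ContDiff ℝ 1 u := by
    rw [hu']; exact R.contDiff.comp (hv.comp R.symm.contDiff)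
  have hud : Differentiable ℝ u := hu1.differentiable one_ne_zero
  set w : E3 → E3 := fun y => u y - v y with hw
  have hw1 : ContDiff ℝ 1 w := hu1.sub hv
  -- `div w = 0`
  have hdivv : VectorCalculus.IsDivFree v := fun y => hdiv y
  have hdivu : VectorCalculus.IsDivFree u := by
    rw [hu']; exact hdivv.conj_linearIsometryEquiv R
  have hdivw : VectorCalculus.IsDivFree w := fun y => by
    show VectorCalculus.divergence (fun y => u y - v y) y = 0
    rw [divergence_sub' hud hvd, hdivu y, hdivv y, sub_zero]
  -- `curl w = 0`
  have hcurlw : ∀ y, curl w y = 0 := fun y => by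
    show curl (fun y => u y - v y) y = 0
    rw [curl_sub' hud hvd, hu, curl_rotZ_neg_conj hvd]
    have hc : curl v (rotZ θ y) = rotZ θ (curl v y) := hcurl θ y
    rw [hc, ← rotZ_add, neg_add_cancel, rotZ_zero, sub_self]
  -- `w ∈ L²`
  have hL2u : MemLp u 2 (volume : Measure E3) := by
    have h1 : MemLp (fun y => v (R.symm y)) 2 (volume : Measure E3) :=
      hL2.comp_measurePreserving R.symm.measurePreserving
    have h2 := (R.toContinuousLinearEquiv : E3 →L[ℝ] E3).comp_memLp' h1
    rw [hu']
    exact h2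
  have hL2w : MemLp w 2 (volume : Measure E3) := hL2u.sub hL2
  -- conclude
  have hw0 := eq_zero_of_curl_eq_zero_of_isDivFree_of_memLp hw1 hcurlw hdivw hL2w
  have hx : u x - v x = 0 := by
    have := congrFun hw0 x
    simpa [hw] using this
  have hux : rotZ (-θ) (v (rotZ θ x)) = v x := sub_eq_zero.1 hx
  calc v (rotZ θ x) = rotZ θ (rotZ (-θ) (v (rotZ θ x))) := by
        rw [← rotZ_add, add_neg_cancel, rotZ_zero]
    _ = rotZ θ (v x) := by rw [hux]

end L918

/-! ## H. Clay link (append-only; ns-claims-typist-7 g5, 2026-08-27): `clayA_of_claimed : ClaimedTheorem →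
ClayVariants.clayR3.Regularity` — the row's «classical glue» (CLAY-LINK AUDIT #1–#116, row 24: standing Gc,
«(G) ⊇ Clay (A) modulo local existence and the energy bound (7) … summit-side glue, not typed») is SUPPLIED
from the tree: Leray's structure theorem in Tao's class of smooth finite-energy solutions
(`Literature.Analysis.FluidPDE.exists_global_finiteEnergy_classical_or_supBlowup`, `ClassicalNSBlowupAlternative.lean`:
local existence, uniqueness, gluing, continuation under an a priori bound — all tree theorems) plus Fatou's
lemma at the endpoint. Nothing above is changed; no statement, locator, class or token of #24 is touched.
New imports: `Literature.Claims.NS.ClayVariants` (the Literature-side mirror of (A)),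
`Literature.Analysis.FluidPDE.ClassicalNSBlowupAlternative`, `Literature.Analysis.FluidPDE.NSLerayHopf` (bridge
`isNavierStokesSolution_and_smooth_iff`). -/

section ClayLink

open _root_.Filter _root_.Topology _root_.Function

/-- **Clay link (was the row's open «classical glue»): the claimed statement implies Fefferman's (A).**
If for every `ν > 0` every smooth finite-energy solution on every `[0,T)` extends smoothly past `T`
(`ClaimedTheorem = ∀ ν > 0, StatementG ν`, Def 2.1), then every Clay datum has a smooth solution on
`ℝ³ × [0,∞)` with bounded energy. Proof over the tree's blow-up alternative for smooth finite-energy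
solutions (`exists_global_finiteEnergy_classical_or_supBlowup`, Leray's structure theorem in Tao's
class): either a global finite-energy classical solution exists (⇒ (A) for the datum, by the bridge
`isNavierStokesSolution_and_smooth_iff`), or there is a maximal finite-energy classical solution on some
`[0,T*)` beyond which NO closed slab carries a finite-energy classical solution from the datum; (G)
extends it to a classical solution on `[0,T')`, `T' > T*`, whose restriction to the closed slab `[0,T*]`
has finite energy — on `[0,T*)` by agreement, at `t = T*` by Fatou's lemma along `tₙ ↑ T*` — a
contradiction. [cite: Shahmurov2026, Def 2.1 l.234–236 (p.7)] [cite: FeffermanClay2006, (A) p. 2] -/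
theorem clayA_of_claimed (h : ClaimedTheorem) : ClayVariants.clayR3.Regularity := by
  intro ν hν u₀ hu₀ hdiv hdec
  have hG : StatementG ν := h ν hν
  have hdiv' : VectorCalculus.IsDivFree u₀ := fun x => hdiv x
  have hH : ∀ n : ℕ, ∫⁻ x, ‖iteratedFDeriv ℝ n u₀ x‖ₑ ^ 2 < ⊤ :=
    hdec.lintegral_enorm_iteratedFDeriv_sq_lt_top
  rcases exists_global_finiteEnergy_classical_or_supBlowup hν hu₀ hdiv' hH with
    ⟨u, p, hcl, hu0, hE, -⟩ | ⟨Ts, hTs, u, p, hcl, hu0, ⟨A, hA, hEA⟩, -, hno⟩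
  · -- global branch: a Clay-sense solution for the datum
    obtain ⟨hns, hsu, hsp⟩ := isNavierStokesSolution_and_smooth_iff.mpr ⟨hcl, hu0⟩
    exact ⟨u, p, hsu, hsp, hns, hE⟩
  · -- maximal branch: contradict maximality with the extension supplied by (G)
    exfalso
    have hsol : IsSmoothFiniteEnergySolutionOn ν Ts u p := by
      refine ⟨hcl, (A ^ (1 / (2 : ℝ))).toReal, fun t ht => ?_⟩
      have hcont : Continuous (u t) := hcl.smooth_velocity.continuous_slice ht
      have hlt : ∫⁻ x, ‖u t x‖ₑ ^ 2 < ⊤ := (hEA t ht).trans_lt hA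
      refine ⟨⟨hcont.aestronglyMeasurable, eLpNorm_two_lt_top_of_lintegral_enorm_sq_lt_top hlt⟩, ?_⟩
      have hle : eLpNorm (u t) 2 volume ≤ A ^ (1 / (2 : ℝ)) := by
        rw [eLpNorm_eq_lintegral_rpow_enorm_toReal two_ne_zero ENNReal.ofNat_ne_top,
          ENNReal.toReal_ofNat]
        simp_rw [ENNReal.rpow_two]
        exact ENNReal.rpow_le_rpow (hEA t ht) (by norm_num)
      exact ENNReal.toReal_mono (ENNReal.rpow_ne_top_of_nonneg (by norm_num) hA.ne) hle
    obtain ⟨T', hT', u', p', hcl', hagree⟩ := hG Ts u p hTs hsol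
    -- the extension on the closed slab `[0, Ts]`
    have hcl'' : IsClassicalNSSolutionOn (Icc 0 Ts) ν 0 u' p' :=
      hcl'.mono (Icc_subset_Ico_right hT') (uniqueDiffOn_Icc hTs)
    have hu'0 : u' 0 = u₀ := by rw [hagree 0 ⟨le_rfl, hTs⟩, hu0]
    refine hno Ts le_rfl u' p' hcl'' hu'0 ⟨A, hA, fun t ht => ?_⟩
    rcases eq_or_lt_of_le ht.2 with rfl | hlt
    · -- Fatou at the endpoint `t = Ts`
      obtain ⟨s, -, hs, hs_tend⟩ := exists_seq_strictMono_tendsto' hTs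
      -- pointwise convergence `u (s n) x → u' t x`
      have hpt : ∀ x, Tendsto (fun n => ‖u (s n) x‖ₑ ^ 2) atTop (𝓝 (‖u' t x‖ₑ ^ 2)) := by
        intro x
        have hcw : ContinuousWithinAt (fun r => u' r x) (Ico 0 T') t :=
          (hcl'.smooth_velocity.differentiableWithinAt_time ⟨ht.1, hT'⟩ x).continuousWithinAt
        have hsW : Tendsto s atTop (𝓝[Ico 0 T'] t) :=
          tendsto_nhdsWithin_iff.2 ⟨hs_tend, Eventually.of_forall fun n =>
            ⟨(hs n).1.le, (hs n).2.trans hT'⟩⟩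
        have h1 : Tendsto (fun n => u' (s n) x) atTop (𝓝 (u' t x)) := hcw.tendsto.comp hsW
        have h2 : (fun n => u' (s n) x) = fun n => u (s n) x := by
          funext n; rw [hagree (s n) ⟨(hs n).1.le, (hs n).2⟩]
        rw [h2] at h1
        exact ((ENNReal.continuous_pow 2).tendsto _).comp ((continuous_enorm.tendsto _).comp h1)
      have hlim : (fun x => ‖u' t x‖ₑ ^ 2) = fun x => liminf (fun n => ‖u (s n) x‖ₑ ^ 2) atTop := by
        funext x; exact ((hpt x).liminf_eq).symm
      have hmeas : ∀ n, AEMeasurable (fun x => ‖u (s n) x‖ₑ ^ 2) (volume : Measure E3) := fun n =>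
        ((hcl.smooth_velocity.continuous_slice ⟨(hs n).1.le, (hs n).2⟩).measurable.enorm.pow_const
          _).aemeasurable
      calc ∫⁻ x, ‖u' t x‖ₑ ^ 2 = ∫⁻ x, liminf (fun n => ‖u (s n) x‖ₑ ^ 2) atTop := by rw [hlim]
        _ ≤ liminf (fun n => ∫⁻ x, ‖u (s n) x‖ₑ ^ 2) atTop := lintegral_liminf_le' hmeas
        _ ≤ A := liminf_le_of_frequently_le (Frequently.of_forall fun n =>
            hEA (s n) ⟨(hs n).1.le, (hs n).2⟩)
    · rw [hagree t ⟨ht.1, hlt⟩]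
      exact hEA t ⟨ht.1, hlt⟩

end ClayLink

end

end Literature.Claims.NS.Shahmurov2026c
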